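import Summits.RiemannHypothesis.RiemannHypothesis.Theorems.Splittings.LinearRayTwoPoint
import Literature.NumberTheory.LFunctions.XiMoments

/-!
# The ONE-POINT (derivative) Laguerre certificate against the linear-factor ray (cell rh-split, C15 / S-dbn-1)

`G_a := F_a′ + a F_a` (`linearFactorH a = a⁻¹ G_a`) satisfies the ODE `G_a′ = a G_a − a² H_0`
(`LinearRayTwoPoint.deriv_rayG`), hence `G_a″ = a G_a′ − a² H_0′`.  Under the ray (only real zeros)
Laguerre's inequality `Re G_a · Re G_a″ ≤ (Re G_a′)²` on the real axis (`LinearRayTwoPoint.laguerre_rayG`)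
therefore reads, with `u = Re G_a(s) = a² Q_a(s)` (`s ≥ 0`), `h = Re H_0(s)`, `h′ = Re H_0′(s)`:
`Q_a(s) · (a h − h′) ≤ h²`.  ONE real point `s ≥ 0` with `h² < Q_a(s)(a h − h′)` refutes the ray at
slope `a` (`not_linearRay_of_onePoint`).  Unlike the two-point certificate of `LinearRayTwoPoint.lean`
this needs no information on an interval — only three numbers at one point (`Q_a(s)`, `H_0(s)`,
`H_0′(s) = −∫₀^∞ u Φ(u) sin(su) du`), which a certified u-side evaluator can supply.
HONEST LABEL: the ray is RH-strengthening (`riemannHypothesis_of_exists_linearRay`); refuting it is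
RH-free bookkeeping; nothing here bears on the truth of RH.
-/

set_option linter.dupNamespace false

noncomputable section

namespace Summit.RiemannHypothesis.RiemannHypothesis.Theorems.Splittings.LinearRayOnePoint

open Complex Filter Topology MeasureTheory Set
open Literature.NumberTheory.LFunctions Literature.Analysis.Complex
open Literature.Barriers.RiemannHypothesis (linearFactorH)
open Summit.RiemannHypothesis.RiemannHypothesis.Theorems
open Summit.RiemannHypothesis.RiemannHypothesis.Theorems.Splittings.LinearRayTwoPoint

/-- THE SECOND-ORDER ODE: `G_a″ = a G_a′ − a² H_0′` on `ℂ`. [folklore] -/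
theorem deriv_deriv_rayG {a : ℝ} (ha : a ≠ 0) (z : ℂ) :
    deriv (deriv (fun z : ℂ => deriv (deBruijnHDiv fun u : ℝ => 1 + u ^ 2 / a ^ 2) z + (a : ℂ) * deBruijnHDiv (fun u : ℝ => 1 + u ^ 2 / a ^ 2) z)) z
      = (a : ℂ) * deriv (fun z : ℂ => deriv (deBruijnHDiv fun u : ℝ => 1 + u ^ 2 / a ^ 2) z + (a : ℂ) * deBruijnHDiv (fun u : ℝ => 1 + u ^ 2 / a ^ 2) z) z
        - (a : ℂ) ^ 2 * deriv (deBruijnH 0) z := by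
  have hfun : deriv (fun z : ℂ => deriv (deBruijnHDiv fun u : ℝ => 1 + u ^ 2 / a ^ 2) z + (a : ℂ) * deBruijnHDiv (fun u : ℝ => 1 + u ^ 2 / a ^ 2) z)
      = fun z : ℂ => (a : ℂ) * (deriv (deBruijnHDiv fun u : ℝ => 1 + u ^ 2 / a ^ 2) z + (a : ℂ) * deBruijnHDiv (fun u : ℝ => 1 + u ^ 2 / a ^ 2) z) - (a : ℂ) ^ 2 * deBruijnH 0 z :=
    funext (deriv_rayG ha)
  have hG : HasDerivAt (fun z : ℂ => deriv (deBruijnHDiv fun u : ℝ => 1 + u ^ 2 / a ^ 2) z + (a : ℂ) * deBruijnHDiv (fun u : ℝ => 1 + u ^ 2 / a ^ 2) z)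
      (deriv (fun z : ℂ => deriv (deBruijnHDiv fun u : ℝ => 1 + u ^ 2 / a ^ 2) z + (a : ℂ) * deBruijnHDiv (fun u : ℝ => 1 + u ^ 2 / a ^ 2) z) z) z :=
    ((differentiable_rayG a) z).hasDerivAt
  have hH : HasDerivAt (deBruijnH 0) (deriv (deBruijnH 0) z) z := ((differentiable_deBruijnH_holds 0) z).hasDerivAt
  have h := (hG.const_mul (a : ℂ)).sub (hH.const_mul ((a : ℂ) ^ 2))
  conv_lhs => rw [hfun]
  exact h.deriv

/-- Real form: `Re G_a″(s) = a Re G_a′(s) − a² Re H_0′(s)`. [folklore] -/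
theorem re_deriv_deriv_rayG {a : ℝ} (ha : a ≠ 0) (s : ℝ) :
    (deriv (deriv (fun z : ℂ => deriv (deBruijnHDiv fun u : ℝ => 1 + u ^ 2 / a ^ 2) z + (a : ℂ) * deBruijnHDiv (fun u : ℝ => 1 + u ^ 2 / a ^ 2) z)) s).re
      = a * (deriv (fun z : ℂ => deriv (deBruijnHDiv fun u : ℝ => 1 + u ^ 2 / a ^ 2) z + (a : ℂ) * deBruijnHDiv (fun u : ℝ => 1 + u ^ 2 / a ^ 2) z) s).re
        - a ^ 2 * (deriv (deBruijnH 0) s).re := by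
  rw [deriv_deriv_rayG ha, Complex.sub_re, Complex.re_ofReal_mul,
    show ((a : ℂ) ^ 2) = ((a ^ 2 : ℝ) : ℂ) by push_cast; ring, Complex.re_ofReal_mul]

/-- **Laguerre at one point, in the three numbers `Q_a(s)`, `H_0(s)`, `H_0′(s)`** (`a > 0`, `s ≥ 0`):
under the ray, `Q_a(s) · (a Re H_0(s) − Re H_0′(s)) ≤ (Re H_0(s))²`. [folklore] -/
theorem fwdAvg_mul_le_sq_of_linearRay {a s : ℝ} (ha : 0 < a) (hs : 0 ≤ s) (hZ : HasOnlyRealZeros (linearFactorH a)) :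
    (∫ y in Ioi (0 : ℝ), deBruijnH 0 ((s : ℂ) + y) * (Real.exp (-(a * y)) : ℂ)).re * (a * (deBruijnH 0 s).re - (deriv (deBruijnH 0) s).re)
      ≤ (deBruijnH 0 s).re ^ 2 := by
  have hL := laguerre_rayG ha.ne' hZ s
  rw [re_deriv_deriv_rayG ha.ne', re_deriv_rayG ha.ne', re_rayG_eq_sq_mul_fwdAvg ha hs] at hL
  set Q := (∫ y in Ioi (0 : ℝ), deBruijnH 0 ((s : ℂ) + y) * (Real.exp (-(a * y)) : ℂ)).re
  set h := (deBruijnH 0 s).re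
  set h' := (deriv (deBruijnH 0) s).re
  -- hL : a²Q · (a(a·a²Q − a²h) − a²h') ≤ (a·a²Q − a²h)²  ⟹  a⁴ (Q(ah − h') − h²) ≤ 0
  have ha4 : 0 < a ^ 4 := by positivity
  nlinarith [hL, ha4]

/-- **One-point certificate.**  `a > 0`, `s ≥ 0` and `(Re H_0(s))² < Q_a(s) · (a Re H_0(s) − Re H_0′(s))`
refute the linear ray at slope `a`. [folklore] -/
theorem not_linearRay_of_onePoint {a s : ℝ} (ha : 0 < a) (hs : 0 ≤ s)
    (hC : (deBruijnH 0 s).re ^ 2 <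
      (∫ y in Ioi (0 : ℝ), deBruijnH 0 ((s : ℂ) + y) * (Real.exp (-(a * y)) : ℂ)).re * (a * (deBruijnH 0 s).re - (deriv (deBruijnH 0) s).re)) :
    ¬ HasOnlyRealZeros (linearFactorH a) := fun hZ =>
  absurd (fwdAvg_mul_le_sq_of_linearRay ha hs hZ) (not_le.2 hC)

/-- The same certificate against the barrier file's constant: a non-real zero of `linearFactorH a`. [folklore] -/
theorem exists_nonreal_zero_linearFactorH_of_onePoint {a s : ℝ} (ha : 0 < a) (hs : 0 ≤ s)
    (hC : (deBruijnH 0 s).re ^ 2 <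
      (∫ y in Ioi (0 : ℝ), deBruijnH 0 ((s : ℂ) + y) * (Real.exp (-(a * y)) : ℂ)).re * (a * (deBruijnH 0 s).re - (deriv (deBruijnH 0) s).re)) :
    ∃ z : ℂ, linearFactorH a z = 0 ∧ z.im ≠ 0 := by
  have h := not_linearRay_of_onePoint ha hs hC
  simp only [HasOnlyRealZeros, not_forall, exists_prop] at h
  obtain ⟨z, hz, hzim⟩ := h
  exact ⟨z, hz, hzim⟩

/-- `Re H_0′(s) = −∫₀^∞ Φ(u) u sin(su) du` at real `s` (the integrand of the u-side evaluator of `H_0′`;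
`XiMoments.iteratedDeriv_deBruijnH_zero` at `k = 1`). [folklore] -/
theorem re_deriv_deBruijnH_zero_ofReal (s : ℝ) :
    (deriv (deBruijnH 0) s).re = -∫ u in Ioi (0:ℝ), deBruijnPhi u * u * Real.sin (s * u) := by
  have h1 : deriv (deBruijnH 0) = deBruijnH0Deriv 1 := by
    have := iteratedDeriv_deBruijnH_zero 1
    rwa [iteratedDeriv_one] at this
  rw [h1, deBruijnH0Deriv]
  have hI : (fun u : ℝ => deBruijnH0DerivIntegrand 1 (s : ℂ) u) = fun u : ℝ => ((-(deBruijnPhi u * u * Real.sin (s * u)) : ℝ) : ℂ) := by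
    funext u
    rw [deBruijnH0DerivIntegrand]
    have : Complex.cos ((s : ℂ) * u + (((1 : ℕ) * (Real.pi / 2) : ℝ) : ℂ)) = ((-(Real.sin (s * u)) : ℝ) : ℂ) := by
      rw [show ((s : ℂ) * u + (((1 : ℕ) * (Real.pi / 2) : ℝ) : ℂ)) = (((s * u + Real.pi / 2 : ℝ)) : ℂ) by push_cast; ring,
        ← Complex.ofReal_cos, Real.cos_add_pi_div_two]
    rw [this]; push_cast; ring
  rw [hI, integral_complex_ofReal, Complex.ofReal_re, integral_neg]

end Summit.RiemannHypothesis.RiemannHypothesis.Theorems.Splittings.LinearRayOnePoint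

end
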